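import Summits.CriticalPhenomena.SAWScalingLimit.Theorems.SAWTensorRGRestrictionOfLimitStubRestrictionOfSqueeze

/-!
# Sanity for `stub_squeezeContinuity`: outer continuity along a squeeze follows from restriction

Support file (`--supports stmt-CriticalPhenomena-0773`, registered stub `stub_squeezeContinuity` of the line
`birth`) for the crux `RestrictionOfLimit` (shared verbatim by the routes SAWConePseudogroup /
SAWConfRestriction / SAWBrownianDomination / SAWTowerCount / SAWTensorRG).

The stub `stub_squeezeContinuity` asserts, for THE scaling limit `P` of the critical `δℤ²` SAW, OUTER
CONTINUITY in the domain along a separated exhausting outer squeeze `E : ℝ → DobrushinDomain` of `D'` inside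
`D`: `∫ f dP(E t) → ∫ f dP(D')` as `t → 0⁺` for every bounded continuous `f`, provided
`P D {γ ⊆ cl D'} ≠ 0`. Here we show that this statement is IMPLIED by the conjectured restriction property
`ChordalFamily.IsRestriction P` of a chordal family `P` (no scaling-limit hypothesis is needed), so the stub
is not stronger than the crux it serves.

Proof. Put `μ = P D`, `R = {γ ⊆ cl D'}`, `R_t = {γ ⊆ cl (E t)}` (closed, measurable events). Restriction for
the pairs `(D, E t)` and `(D, D')` gives `P (E t) (T) = μ (T ∩ R_t) / μ (R_t)` and
`P D' (T) = μ (T ∩ R) / μ (R)` (`μ (R_t) ≥ μ (R) > 0`). Separation forces the nesting `E s ⊆ E t`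
(`subset_of_closure_inter_closure_diff_eq_empty`), so `R_t ↓ R` as `t ↓ 0` by exhaustion, and continuity from
above (`tendsto_measure_inter_of_squeeze`) gives `μ (T ∩ R_t) → μ (T ∩ R)`; hence `P (E t) (T) → P D' (T)` for
every Borel `T` along `𝓝[>] 0`. Setwise convergence on open sets is the liminf condition of the portmanteau
theorem (`tendsto_of_forall_isOpen_le_liminf'`), so `P (E t) ⇒ P D'` weakly, i.e. integrals of bounded
continuous functions converge (`ProbabilityMeasure.tendsto_iff_forall_integral_tendsto`).

No named fact is used; axioms `propext`, `Classical.choice`, `Quot.sound`. References: G. F. Lawler,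
O. Schramm, W. Werner, *Conformal restriction: the chordal case* (2003), §3; P. Billingsley, *Convergence of
probability measures* (1999), Thm 2.1 (portmanteau).
-/

noncomputable section

open MeasureTheory Filter Topology Set Metric Literature.Probability.RandomPlanarGeometry
  Literature.Probability.LatticeModels
open scoped ENNReal NNReal BoundedContinuousFunction

namespace Summit.CriticalPhenomena.SAWScalingLimit.Theorems.RestrictionOfLimit.Birth

/-- **Outer continuity along a squeeze from the restriction property** (sanity for the registered stub
`stub_squeezeContinuity`). For a chordal family `P` with the restriction property, Dobrushin `D' ⊆ D` with the
same marked points, and a family `E : ℝ → DobrushinDomain` with, for `t > 0`, `D' ⊆ E t ⊆ D` and the marked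
points of `D`; SEPARATED (`cl (E s) ∩ cl (D ∖ E t) = ∅` for `0 < s < t`); EXHAUSTING (`γ ⊆ cl (E t)` for all
`t > 0` implies `γ ⊆ cl D'`); and with `P D {γ ⊆ cl D'} ≠ 0`: `∫ f dP(E t) → ∫ f dP(D')` as `t → 0⁺` for every
bounded continuous `f`. Proof: by restriction `P (E t) = P D (· ∩ R_t) / P D (R_t)` and
`P D' = P D (· ∩ R) / P D (R)` with `R_t = {γ ⊆ cl (E t)} ↓ R = {γ ⊆ cl D'}`; continuity from above gives
setwise convergence, and the portmanteau theorem upgrades setwise convergence on open sets to weak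
convergence. [folklore] -/
theorem squeezeContinuity_of_isRestriction {P : ChordalFamily} (hch : P.IsChordal) (hres : P.IsRestriction)
    {D D' : DobrushinDomain} (hsub : D'.carrier ⊆ D.carrier) (h0 : D'.pt 0 = D.pt 0) (h1 : D'.pt 1 = D.pt 1)
    (E : ℝ → DobrushinDomain)
    (hN : ∀ t : ℝ, 0 < t → D'.carrier ⊆ (E t).carrier ∧ (E t).carrier ⊆ D.carrier ∧
      (E t).pt 0 = D.pt 0 ∧ (E t).pt 1 = D.pt 1)
    (hS : ∀ s t : ℝ, 0 < s → s < t → closure (E s).carrier ∩ closure (D.carrier \ (E t).carrier) = ∅)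
    (hX : ∀ γ : CurveClass ℂ, (∀ t : ℝ, 0 < t → γ.range ⊆ closure (E t).carrier) →
      γ.range ⊆ closure D'.carrier)
    (hR : P D (CurveClass.rangeSubset (closure D'.carrier)) ≠ 0) (f : CurveClass ℂ →ᵇ ℝ) :
    Tendsto (fun t : ℝ => ∫ γ, f γ ∂(P (E t))) (𝓝[>] (0 : ℝ)) (𝓝 (∫ γ, f γ ∂(P D'))) := by
  haveI hprob : ∀ D₀ : DobrushinDomain, IsProbabilityMeasure (P D₀) := fun D₀ => (hch D₀).1
  set R : Set (CurveClass ℂ) := CurveClass.rangeSubset (closure D'.carrier) with hRdef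
  -- nesting of the squeeze (from separation) and of the events `{γ ⊆ cl (E t)}`
  have hmonoE : ∀ s t : ℝ, 0 < s → s ≤ t → (E s).carrier ⊆ (E t).carrier := by
    intro s t hs hst
    rcases hst.eq_or_lt with rfl | hlt
    · exact Subset.rfl
    · exact subset_of_closure_inter_closure_diff_eq_empty (hN s hs).2.1 (hS s t hs hlt)
  have hmonoR : ∀ s t : ℝ, 0 < s → s ≤ t →
      (CurveClass.rangeSubset (closure (E s).carrier) : Set (CurveClass ℂ)) ⊆
        CurveClass.rangeSubset (closure (E t).carrier) :=
    fun s t hs hst γ hγ => CurveClass.mem_rangeSubset.2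
      ((CurveClass.mem_rangeSubset.1 hγ).trans (closure_mono (hmonoE s t hs hst)))
  have hRsub : ∀ t : ℝ, 0 < t → R ⊆ CurveClass.rangeSubset (closure (E t).carrier) :=
    fun t ht γ hγ => CurveClass.mem_rangeSubset.2
      ((CurveClass.mem_rangeSubset.1 hγ).trans (closure_mono (hN t ht).1))
  -- continuity from above along `t → 0⁺`
  have hcont : ∀ T : Set (CurveClass ℂ), MeasurableSet T →
      Tendsto (fun t : ℝ => P D (T ∩ CurveClass.rangeSubset (closure (E t).carrier))) (𝓝[>] (0 : ℝ))
        (𝓝 (P D (T ∩ R))) := fun T hT =>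
    tendsto_measure_inter_of_squeeze (μ := P D)
      (Rt := fun t : ℝ => (CurveClass.rangeSubset (closure (E t).carrier) : Set (CurveClass ℂ)))
      (fun t _ => CurveClass.measurableSet_rangeSubset isClosed_closure) hmonoR hRsub
      (fun γ hγ => CurveClass.mem_rangeSubset.2
        (hX γ fun t ht => CurveClass.mem_rangeSubset.1 (hγ t ht))) hT
  -- setwise convergence `P (E t) (T) → P D' (T)` along `t → 0⁺`
  have hset : ∀ T : Set (CurveClass ℂ), MeasurableSet T →
      Tendsto (fun t : ℝ => P (E t) T) (𝓝[>] (0 : ℝ)) (𝓝 (P D' T)) := by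
    intro T hT
    have hden : Tendsto (fun t : ℝ => P D (CurveClass.rangeSubset (closure (E t).carrier)))
        (𝓝[>] (0 : ℝ)) (𝓝 (P D R)) := by
      simpa only [univ_inter] using hcont univ MeasurableSet.univ
    have hD' : P D' T = P D (T ∩ R) / P D R := by
      refine (ENNReal.eq_div_iff hR (measure_ne_top _ _)).2 ?_
      rw [mul_comm]
      exact hres D D' hsub h0 h1 T hT
    rw [hD']
    refine (ENNReal.Tendsto.div (hcont T hT) (Or.inr hR) hden (Or.inl (measure_ne_top _ _))).congr' ?_
    filter_upwards [self_mem_nhdsWithin] with t ht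
    have hne : P D (CurveClass.rangeSubset (closure (E t).carrier)) ≠ 0 :=
      fun h => hR (measure_mono_null (hRsub t ht) h)
    refine ((ENNReal.eq_div_iff hne (measure_ne_top _ _)).2 ?_).symm
    rw [mul_comm]
    exact hres D (E t) (hN t ht).2.1 (hN t ht).2.2.1 (hN t ht).2.2.2 T hT
  -- portmanteau: setwise convergence on open sets gives weak convergence
  have hweak : Tendsto (β := ProbabilityMeasure (CurveClass ℂ)) (fun t : ℝ => ⟨P (E t), hprob (E t)⟩)
      (𝓝[>] (0 : ℝ)) (𝓝 ⟨P D', hprob D'⟩) :=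
    tendsto_of_forall_isOpen_le_liminf' fun G hG => ((hset G hG.measurableSet).liminf_eq).ge
  exact ProbabilityMeasure.tendsto_iff_forall_integral_tendsto.1 hweak f

/-- **Registered stub `stub_squeezeContinuityOfRestriction` (sanity for `stub_squeezeContinuity`).** The statement
of the registered stub `stub_squeezeContinuity` (outer continuity of the law in the domain along a separated
exhausting outer squeeze `E t ↓ D'` inside `D`, given `P D {γ ⊆ cl D'} ≠ 0`) with the scaling-limit hypothesis
`SAW.IsScalingLimitFamily P` replaced by `P.IsChordal ∧ P.IsRestriction`: the squeeze-continuity stub is implied by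
the restriction property of the family, hence is not stronger than the crux `RestrictionOfLimit` it serves. Closed
form of `squeezeContinuity_of_isRestriction`. [folklore] -/
theorem stub_squeezeContinuityOfRestriction :
    ∀ P : ChordalFamily, P.IsChordal → P.IsRestriction →
      ∀ (D D' : DobrushinDomain), D'.carrier ⊆ D.carrier → D'.pt 0 = D.pt 0 → D'.pt 1 = D.pt 1 →
        ∀ E : ℝ → DobrushinDomain,
          (∀ t : ℝ, 0 < t → D'.carrier ⊆ (E t).carrier ∧ (E t).carrier ⊆ D.carrier ∧
            (E t).pt 0 = D.pt 0 ∧ (E t).pt 1 = D.pt 1) →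
          (∀ s t : ℝ, 0 < s → s < t → closure (E s).carrier ∩ closure (D.carrier \ (E t).carrier) = ∅) →
          (∀ γ : CurveClass ℂ, (∀ t : ℝ, 0 < t → γ.range ⊆ closure (E t).carrier) →
            γ.range ⊆ closure D'.carrier) →
          P D (CurveClass.rangeSubset (closure D'.carrier)) ≠ 0 →
            ∀ f : CurveClass ℂ →ᵇ ℝ, Tendsto (fun t : ℝ => ∫ γ, f γ ∂(P (E t))) (𝓝[>] (0 : ℝ))
              (𝓝 (∫ γ, f γ ∂(P D'))) :=
  fun _ hch hres _ _ hsub h0 h1 E hN hS hX hR f =>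
    squeezeContinuity_of_isRestriction hch hres hsub h0 h1 E hN hS hX hR f

end Summit.CriticalPhenomena.SAWScalingLimit.Theorems.RestrictionOfLimit.Birth

end
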